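import Summits.QuantumFields.BalabanUV.Beta.GAN24.VHWordsZeroBorder

/-!
# `BalabanUV.Beta.GAN24.VHWordsZeroCell` — binder row G-an2-4 ∕ (CONV-C), W-slot CT-W, conservation law (C)∕(C)sym, step (L3) of this lineage's note
# `HOME/b2b-balaban-gan24-formalise-leaf-04/g65/CSYM-LEVEL0-KERNEL-BLUEPRINT.md` §6 («VH words: located open»): **THE LAST TWO SECTOR WORDS — `S^E ⊗ S^VH` WITH THE BORDER SLOT ON THE
# LATTICE BOND — VANISH IN THE ZERO MODE** (not bond by bond): the lattice-summed border slot is a coarse-constant multiplier profile (`VHSlotProfile`), which the fm block of `X̃♮_j` reads as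
# its exit-FACE column charge (`DressedStepFaceCharges.hasSum_dressedStep_col`); what is left of the Wilson slot is the FACE-WEIGHTED exit-face-read left current, whose CELL TOTAL
# vanishes: `Σ_{r∈cell} 𝟙f(r_m)·(curvAdj F)_m(r) = ⟨𝟙f(x_m) dx_m, curvAdj F⟩_cell = ⟨curv (𝟙f(x_m) dx_m), F⟩_cell = 0`, the 1-form `𝟙f(x_m) dx_m` being FLAT

NOT IN PRINT; OUR BOOKKEEPING ([folklore] BY NAME over this lineage's `VHSlotProfile ∕ VHWordsZeroBorder ∕ VHWordsZeroLattice ∕ ExchangeSlotResum ∕ EEWordValue.fubini3 ∕ EEWordReduced ∕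
CoarseBondCellPairing ∕ DressedKernelOnFaceCurrent ∕ DressedWilsonHalfVertexAnyAxis ∕ PeriodicCellPairing`, an2's kernel calculus, leaf-02's `BubbleParity ∕ LayerCommutatorAntisymm`; G-an2-4
formalisation swarm, leaf prover `b2b-balaban-gan24-formalise-leaf-04`, gen 66).  HONEST FRAMING (cell contract, verbatim): «discharging `BetaPertH` makes Bałaban's UV stability UNCONDITIONAL
— a real constructive-QFT result; it is NOT the continuum limit and NOT the Clay problem.»  HONEST DEPENDENCY (verbatim): «continuum YM on T⁴ ⇐ BetaPertH ∧ nine spine estimates (0/9 proved);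
BetaPertH ⇐ (D1) ∧ (D4) ∧ CAP+tail; G-an2-4 gates asym, D1 and NE2/3/4.»

WHAT ([folklore]; generic `d`; 0 `def`, 0 cited facts, 0 `def … : Prop`, 0 sorry): §1 **`curv_axialFace_eq_zero`** (the 1-form `A_{m′}(x) = [m′ = m]·g(x_m)` is flat),
**`sum_box_face_mul_curvAdj_eq_zero`** (`Σ_{r∈box N} g(r_m)·curvAdj F m r = 0` for every `N`-periodic 2-form `F` and `N`-periodic `g` — `PeriodicCellPairing.sum_box_curvAdj_mul`); §2 (generic,
blocking `N ≥ 1`) `comp_noFM_inl_inr`, **`tsum_ffLeft_profile_right_word_eq`** — for a left factor `P` bi-localised at one point with NO field–multiplier block, a decaying middle kernel `Y`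
with fm column charges `HasSum (z′ ↦ Y y₁ (N•z′) (inl a) (inr m)) (cY a m y₁)`, and a border slot `Q` (bi-localised, block-covariant, no ff block, multiplier first legs coarse):
`Σ'_{u′} FF[(P ∘ Y) ∘ Q_{u′}] = Σ'_{y₁} Σ_a (Σ'_y ρ₁(y)·P y y₁ (inl α)(inl a))·(Σ_m cY a m y₁·T_m(0))`, `T_m(z) = Σ'_{(u,w)} ρ₂(w)·Q u z w (inr m)(inl β)`; §3 (in-block root, `1 ≤ Lc`, EVERY
level `j`, all units; `S′` a border table as in `VHWordsZeroBorder`; `V^E_{μ,c} = vertexOfK X̃♮_j Lc S^E μ c`, `Q_{ν,u} = vertexOfK X̃♮_j Lc (unitS s_f s_m S′) ν u`):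
**`sum_box_wilson_border_word_eq_zero`** (DIRECT, zero mode: `Σ_{c∈box N′} Σ'_{u′} Σ'_{(y,w)} 𝟙f(y_α)𝟙f(w_β)·((V^E_{μ,c} ∘ X̃♮_j) ∘ Q_{ν,u′}) y w (inl α)(inl β) = 0`),
**`sum_box_border_wilson_swap_word_eq_zero`** (SWAP, zero mode: `Σ_{c∈box N′} Σ'_{u′} FF[(Q_{ν,u′} ∘ X̃♮_j) ∘ V^E_{μ,c}] = 0`, by transposition through `sgnK X̃♮_j`).  With 18 ∕ 20 ∕ 23 ∕ 24 ∕ 26 this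
CLOSES the ledger of the 18 sector words of the two exchange words of `DressedSourceZeroModeWords.zmode_dressedSource_inl_inl` at level `0`: only the two `S^E ⊗ S^E` NUMBERS survive.  Asserts NO
value of Bałaban's tables beyond an1's ∕ an3's DEFINED tables; discharges NOTHING of (C)sym ∕ (Q-D) ∕ (Q-D-rate) ∕ «T2Shape» ∕ «T2Drift» ∕ (hW, hWall); NEVER «G-an2-4 closed» as (CONV-C); NOT
D1, NOT `BetaPertH`, NOT continuum, NOT Clay.  2026-08-23; no existing file touched.
-/

noncomputable section

open Finset
open scoped BigOperators
open Literature.MathematicalPhysics.QuantumFieldTheory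
open Literature.MathematicalPhysics.QuantumFieldTheory.Balaban1983to89
open Literature.MathematicalPhysics.QuantumFieldTheory.Balaban1983to89.Beta
open B12Sec2to5 (l1 l1_nonneg)
open ExpKernelCalculus (Site MKer comp shiftK Decays BiLoc VertexFamily Zl Zl_nonneg)
open OneStepResolventKernel (Fib LocStencil wsum decays_mono biLoc_mono)
open BalabanStepJetsSucc (biLoc_comp_right)
open OneStepKernelFamily (KInvStep vertexOfK vertexFamily_vertexOfK decays_KInvStep)
open StepJetData (wilsonA locStencil_wilsonA locStencil_smul)
open AffineAveraging (Form1 Form2 box toSite curv curvAdj unitVec unitVec_apply)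
open AveragingContours (off)
open PeriodicDescent (IsPeriodic)
open Summit.QuantumFields.BalabanUV.Beta.TameKernelCalculus (trK trK_apply trK_comp biLoc_trK Loc Spr Tame comp_assoc_tame comp_neg_left comp_neg_right)
open Summit.QuantumFields.BalabanUV.Beta.BorderedHessian (sgnK sgnK_apply sgnF_inl sgnF_inr decays_sgnK)
open Summit.QuantumFields.BalabanUV.Beta.BubbleParity (trK_vertexOfK_of_antisymm)
open Summit.QuantumFields.BalabanUV.Beta.AxialDressingRooted (coDressKBmAt decays_coDressKBmAt)
open Summit.QuantumFields.BalabanUV.Beta.HessKerDressedUnits (unitK unitS unitS_apply decays_unitK locStencil_unitS)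
open Summit.QuantumFields.BalabanUV.Beta.GAN24.PeriodicCellPairing (sum_box_curvAdj_mul)
open Summit.QuantumFields.BalabanUV.Beta.GAN24.PeriodicForceMultiplier (bounded_of_periodic)
open Summit.QuantumFields.BalabanUV.Beta.GAN24.EEWordReduced (shiftK_dressedStep leftFamily_cov summable_leftFamily_mul)
open Summit.QuantumFields.BalabanUV.Beta.GAN24.CoarseBondCellPairing (sum_box_tsum_sum_mul_periodic_of_cov)
open Summit.QuantumFields.BalabanUV.Beta.GAN24.DressedStepFaceCharges (hasSum_dressedStep_col)
open Summit.QuantumFields.BalabanUV.Beta.GAN24.DressedKernelOnFaceCurrent (facePlaq_periodic tsum_faceHalfVertex_fst)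
open Summit.QuantumFields.BalabanUV.Beta.GAN24.DressedWilsonHalfVertexAnyAxis (tsum_faceHalfVertex_fst_diag)
open Summit.QuantumFields.BalabanUV.Beta.GAN24.ExchangeFieldLegs (vertexOfK_wilson_inl_inr)
open Summit.QuantumFields.BalabanUV.Beta.GAN24.EEWordValue (fubini3)
open Summit.QuantumFields.BalabanUV.Beta.GAN24.LayerCommutatorAntisymm (trK_unitK_coDress)
open Summit.QuantumFields.BalabanUV.Beta.GAN24.ExchangeSlotResum (hasSum_slot_word tsum_twoFace_eq_trK face_weight_periodic)
open Summit.QuantumFields.BalabanUV.Beta.GAN24.VHWordsZeroLattice (vertexOfK_unitS_noFF_inl_inl unitS_wilsonA_antisymm)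
open Summit.QuantumFields.BalabanUV.Beta.GAN24.VHSlotProfile (tsum_pair_slot_periodic tsum_pair_slot_eq_zero_of_off tsum_col_mul_profile abs_tsum_pair_slot_le)
open Summit.QuantumFields.BalabanUV.Beta.GAN24.VHWordsZeroBorder (borderSlot_translate borderSlot_inr_fst_eq_zero borderSlot_inr_snd_eq_zero)

namespace Summit.QuantumFields.BalabanUV.Beta.GAN24.VHWordsZeroCell

variable {d : ℕ}

/-! ## §1 The face-weighted cell total of a co-differential vanishes -/

/-- [folklore] **THE AXIAL FACE 1-FORM `A_{m′}(x) = [m′ = m]·g(x_m)` IS FLAT**: `curv A = 0` (every `g : ℤ → ℝ`). -/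
theorem curv_axialFace_eq_zero (m : Fin (d + 1)) (g : ℤ → ℝ) :
    curv (fun (m' : Fin (d + 1)) (x : AffineAveraging.Site (d + 1)) => if m' = m then g (x m) else 0) = 0 := by
  funext κ l x
  simp only [curv, Pi.zero_apply, Pi.add_apply, unitVec_apply]
  by_cases hκ : κ = m <;> by_cases hl : l = m
  · subst hκ; subst hl; simp
  · subst hκ; simp [hl, Ne.symm hl]
  · subst hl; simp [hκ, Ne.symm hκ]
  · simp [hκ, hl]

/-- [folklore] **THE FACE-WEIGHTED CELL TOTAL OF A CO-DIFFERENTIAL VANISHES**: for an `N`-periodic 2-form `F` and an `N`-periodic weight `g`,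
`Σ_{r ∈ box N} g(r_m)·(curvAdj F)_m (r) = 0` — cell adjointness `⟨A, curvAdj F⟩_cell = ⟨curv A, F⟩_cell` (`PeriodicCellPairing.sum_box_curvAdj_mul`) with the flat `A` of
`curv_axialFace_eq_zero`.  (For `g = 𝟙f` and `F = F_{μα}` this is the telescoping `Σ_{x_α} (𝟙f(x_α) − 𝟙f(x_α − 1)) = 0` of the exit-face edge current.) -/
theorem sum_box_face_mul_curvAdj_eq_zero {N : ℕ} [NeZero N] {F : Form2 (d + 1) ℝ} (hF : ∀ κ l, IsPeriodic N (F κ l)) {g : ℤ → ℝ} (hg : ∀ n k : ℤ, g (n + (N : ℤ) * k) = g n)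
    (m : Fin (d + 1)) :
    ∑ r ∈ box (d + 1) N, g (toSite r m) * curvAdj F m (toSite r) = 0 := by
  have hA : ∀ κ : Fin (d + 1), IsPeriodic N ((fun (m' : Fin (d + 1)) (x : AffineAveraging.Site (d + 1)) => if m' = m then g (x m) else 0) κ) := by
    intro κ x a
    by_cases hκ : κ = m
    · simp only [hκ, if_true, Pi.add_apply, Pi.smul_apply, smul_eq_mul, hg]
    · simp only [hκ, if_false]
  have h := sum_box_curvAdj_mul (N := N) hF hA
  simp only [curv_axialFace_eq_zero m g, Pi.zero_apply, mul_zero, Finset.sum_const_zero] at h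
  rw [← h]
  refine Finset.sum_congr rfl fun r _ => ?_
  rw [Finset.sum_eq_single m (fun m' _ hm' => by rw [if_neg hm', mul_zero]) (fun hm => absurd (Finset.mem_univ m) hm), if_pos rfl, mul_comm]

/-! ## §2 A left factor with no field–multiplier block against a border slot: reduction to the fm column charges -/

section Generic

variable {N : ℕ} [NeZero N]
variable {P Y : MKer (d + 1) (Fib d)} {Q : Site (d + 1) → MKer (d + 1) (Fib d)} {p : Site (d + 1)} {CP CY CQ CA : ℝ} {δ : ℝ} {ρ₁ ρ₂ : Site (d + 1) → ℝ} {α β : Fin (d + 1)}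
  {cY : Fin (d + 1) → Fin (d + 1) → Site (d + 1) → ℝ}

omit [NeZero N] in
/-- [folklore] The `(inl, inr)` entries of `P ∘ Y` run through FIELD middle legs only when `P` has no field–multiplier block. -/
theorem comp_noFM_inl_inr (hPfm : ∀ (y z : Site (d + 1)) (α' m : Fin (d + 1)), P y z (Sum.inl α') (Sum.inr m) = 0) (y z : Site (d + 1)) (α' m : Fin (d + 1)) :
    comp P Y y z (Sum.inl α') (Sum.inr m) = ∑' y₁ : Site (d + 1), ∑ a : Fin (d + 1), P y y₁ (Sum.inl α') (Sum.inl a) * Y y₁ z (Sum.inl a) (Sum.inr m) := by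
  simp only [comp, Fintype.sum_sum_type, hPfm, zero_mul, Finset.sum_const_zero, add_zero]

/-- [folklore] **REDUCTION OF A TWO-FACE WORD `(P ∘ Y) ∘ Q_{u′}` WITH A BORDER SLOT TO THE fm COLUMN CHARGES OF `Y`**: `P` bi-localised at one point with NO field–multiplier block
(the Wilson chain-rule vertex), `Y` decaying with fm column charges `HasSum (z′ ↦ Y y₁ (N•z′) (inl a) (inr m)) (cY a m y₁)`, `|cY| ≤ CcY`, the border slot `Q` as in `VHSlotProfile` ⟹
`Σ'_{u′} Σ'_{(y,w)} ρ₁ρ₂·((P ∘ Y) ∘ Q_{u′}) y w (inl α)(inl β) = Σ'_{y₁} Σ_a (Σ'_y ρ₁(y)·P y y₁ (inl α)(inl a))·(Σ_m cY a m y₁·T_m(0))`, `T_m(z) = Σ'_{(u,w)} ρ₂(w)·Q u z w (inr m)(inl β)`. -/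
theorem tsum_ffLeft_profile_right_word_eq (hδ : 0 < δ) (hP : BiLoc P p p CP δ)
    (hPfm : ∀ (y z : Site (d + 1)) (α' m : Fin (d + 1)), P y z (Sum.inl α') (Sum.inr m) = 0)
    (hY : Decays Y CY δ) (hYfm : ∀ (y₁ : Site (d + 1)) (a m : Fin (d + 1)), HasSum (fun z' : Site (d + 1) => Y y₁ ((N : ℤ) • z') (Sum.inl a) (Sum.inr m)) (cY a m y₁))
    (hA : BiLoc (comp P Y) p p CA δ)
    (hQ : ∀ u, BiLoc (Q u) ((N : ℤ) • u) ((N : ℤ) • u) CQ δ) (hQcov : ∀ u s : Site (d + 1), Q (u + s) = shiftK (-((N : ℤ) • s)) (Q u))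
    (hQff : ∀ (u z w : Site (d + 1)) (b' b : Fin (d + 1)), Q u z w (Sum.inl b') (Sum.inl b) = 0)
    (hQsupp : ∀ (u z w : Site (d + 1)) (m : Fin (d + 1)) (b : Fib d), off N z ≠ 0 → Q u z w (Sum.inr m) b = 0)
    (h₁ : ∀ y, |ρ₁ y| ≤ 1) (h₂ : ∀ w, |ρ₂ w| ≤ 1) (hρ₂ : ∀ w s : Site (d + 1), ρ₂ (w + (N : ℤ) • s) = ρ₂ w) :
    ∑' u' : Site (d + 1), ∑' yw : Site (d + 1) × Site (d + 1), ρ₁ yw.1 * ρ₂ yw.2 * comp (comp P Y) (Q u') yw.1 yw.2 (Sum.inl α) (Sum.inl β) =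
      ∑' y₁ : Site (d + 1), ∑ a : Fin (d + 1), (∑' y : Site (d + 1), ρ₁ y * P y y₁ (Sum.inl α) (Sum.inl a)) *
        (∑ m : Fin (d + 1), cY a m y₁ * (∑' uw : Site (d + 1) × Site (d + 1), ρ₂ uw.2 * Q uw.1 0 uw.2 (Sum.inr m) (Sum.inl β))) := by
  classical
  have hCP : 0 ≤ CP := hP.nonneg (Sum.inl 0)
  have hCY : 0 ≤ CY := hY.nonneg (Sum.inl 0)
  have hCQ : 0 ≤ CQ := (hQ 0).nonneg (Sum.inl 0)
  -- step 1: resum the border slot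
  rw [(hasSum_slot_word (N := N) (A := comp P Y) (Q := Q) hδ hA hQ h₁ h₂ (Sum.inl α) (Sum.inl β)).tsum_eq, Fintype.sum_sum_type]
  -- step 2: field middle legs: the slot has no ff block
  have hinl : ∀ b' : Fin (d + 1), (∑' yz : Site (d + 1) × Site (d + 1), ρ₁ yz.1 * comp P Y yz.1 yz.2 (Sum.inl α) (Sum.inl b') *
      ∑' uw : Site (d + 1) × Site (d + 1), ρ₂ uw.2 * Q uw.1 yz.2 uw.2 (Sum.inl b') (Sum.inl β)) = 0 := by
    intro b'
    simp only [hQff, mul_zero, tsum_zero]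
  simp only [hinl, Finset.sum_const_zero, zero_add]
  -- step 3: multiplier middle legs: the profile, `fubini3`, the fm column charges
  set T : Fin (d + 1) → Site (d + 1) → ℝ := fun m z => ∑' uw : Site (d + 1) × Site (d + 1), ρ₂ uw.2 * Q uw.1 z uw.2 (Sum.inr m) (Sum.inl β) with hT
  have hfold : ∀ (m : Fin (d + 1)) (z : Site (d + 1)), (∑' uw : Site (d + 1) × Site (d + 1), ρ₂ uw.2 * Q uw.1 z uw.2 (Sum.inr m) (Sum.inl β)) = T m z := fun m z => rfl
  simp only [hfold]
  have hTb : ∀ (m : Fin (d + 1)) (z : Site (d + 1)), |T m z| ≤ CQ * (Real.exp (δ * ((N : ℝ) * (d + 1))) * Zl (d + 1) δ) * Zl (d + 1) δ :=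
    fun m z => abs_tsum_pair_slot_le (N := N) hδ hQ h₂ z (Sum.inr m) (Sum.inl β)
  have hM : 0 ≤ CQ * (Real.exp (δ * ((N : ℝ) * (d + 1))) * Zl (d + 1) δ) * Zl (d + 1) δ := by
    have hZ : 0 ≤ Zl (d + 1) δ := Zl_nonneg hδ
    positivity
  have e3 : ∀ m : Fin (d + 1), (∑' yz : Site (d + 1) × Site (d + 1), ρ₁ yz.1 * comp P Y yz.1 yz.2 (Sum.inl α) (Sum.inr m) * T m yz.2) =
      ∑' yz : Site (d + 1) × Site (d + 1), ρ₁ yz.1 * (∑' y₁ : Site (d + 1), ∑ a : Fin (d + 1), P yz.1 y₁ (Sum.inl α) (Sum.inl a) * Y y₁ yz.2 (Sum.inl a) (Sum.inr m)) * T m yz.2 :=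
    fun m => tsum_congr fun yz => by rw [comp_noFM_inl_inr hPfm]
  simp only [e3]
  rw [fubini3 (ι := Fin (d + 1)) (f := ρ₁) (V := fun y y₁ a => P y y₁ (Sum.inl α) (Sum.inl a)) (X := fun y₁ z a m => Y y₁ z (Sum.inl a) (Sum.inr m))
    (T := T) (c := p) hδ hCP hCY hM h₁ (fun y y₁ a => hP y y₁ (Sum.inl α) (Sum.inl a)) (fun y₁ z a m => hY y₁ z (Sum.inl a) (Sum.inr m)) hTb]
  refine tsum_congr fun y₁ => Finset.sum_congr rfl fun a _ => ?_
  congr 1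
  have hs : ∀ m : Fin (d + 1), Summable fun z : Site (d + 1) => Y y₁ z (Sum.inl a) (Sum.inr m) * T m z := by
    intro m
    refine Summable.of_norm_bounded (((ExpKernelCalculus.summable_exp_shift hδ y₁).mul_left CY).mul_right
      (CQ * (Real.exp (δ * ((N : ℝ) * (d + 1))) * Zl (d + 1) δ) * Zl (d + 1) δ)) (fun z => ?_)
    rw [Real.norm_eq_abs, abs_mul]
    exact mul_le_mul (hY y₁ z (Sum.inl a) (Sum.inr m)) (hTb m z) (abs_nonneg _) (by positivity)
  rw [Summable.tsum_finsetSum (fun m _ => hs m)]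
  refine Finset.sum_congr rfl fun m _ => ?_
  exact tsum_col_mul_profile (N := N) (hYfm y₁ a m) (fun z s => tsum_pair_slot_periodic (N := N) hQcov hρ₂ z s (Sum.inr m) (Sum.inl β))
    (fun z hz => tsum_pair_slot_eq_zero_of_off (N := N) hQsupp ρ₂ hz m (Sum.inl β))

end Generic

/-! ## §3 The `S^E ⊗ S^VH` words with the border slot on the lattice bond: zero in the zero mode, every level -/

section Instances

variable {Lc : ℕ} [NeZero Lc] {r : Fin (d + 1) → ℕ} {S' : Fin (d + 1) → Site (d + 1) → MKer (d + 1) (Fib d)} {Cs δs : ℝ} {μ ν α β : Fin (d + 1)}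

/-- [folklore] **THE fm COLUMN CHARGE OF THE DRESSED STEP KERNEL** (`DressedStepFaceCharges.hasSum_dressedStep_col` on a field leg): against `inr m` at the coarse points, the field leg
`inl a` at `y₁` reads `[y₁_a % Lc = Lc − 1]·Lc·(s_m s_f)·δ_{am}·σ_j`. -/
theorem hasSum_dressedStep_fm_col (hLc : 1 ≤ Lc) (hr : r ∈ box (d + 1) Lc) (sf sm : ℝ) (j : ℕ) (y₁ : Site (d + 1)) (a m : Fin (d + 1)) :
    HasSum (fun z' : Site (d + 1) => unitK sf sm (coDressKBmAt (toSite r) Lc (KInvStep (d := d) Lc j)) y₁ ((Lc : ℤ) • z') (Sum.inl a) (Sum.inr m))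
      (if y₁ a % (Lc : ℤ) = (Lc : ℤ) - 1 then ((Lc : ℝ) * (sm * sf)) * (if a = m then ((((Lc ^ (j + 1) : ℕ) : ℝ)) ^ (d + 1 + 1))⁻¹ else 0) else 0) := by
  have h := hasSum_dressedStep_col (d := d) hLc hr sf sm j m (Sum.inl a) y₁
  simpa only [Sum.elim_inl] using h

/-- [folklore] … and that of `sgnK X̃♮_j` is its negative (the fm block of `sgnK` changes sign). -/
theorem hasSum_sgnK_dressedStep_fm_col (hLc : 1 ≤ Lc) (hr : r ∈ box (d + 1) Lc) (sf sm : ℝ) (j : ℕ) (y₁ : Site (d + 1)) (a m : Fin (d + 1)) :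
    HasSum (fun z' : Site (d + 1) => sgnK (unitK sf sm (coDressKBmAt (toSite r) Lc (KInvStep (d := d) Lc j))) y₁ ((Lc : ℤ) • z') (Sum.inl a) (Sum.inr m))
      (-(if y₁ a % (Lc : ℤ) = (Lc : ℤ) - 1 then ((Lc : ℝ) * (sm * sf)) * (if a = m then ((((Lc ^ (j + 1) : ℕ) : ℝ)) ^ (d + 1 + 1))⁻¹ else 0) else 0)) := by
  refine (hasSum_dressedStep_fm_col hLc hr sf sm j y₁ a m).neg.congr_fun fun z' => ?_
  rw [sgnK_apply, sgnF_inl, sgnF_inr]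
  ring

/-- [folklore] The resummed charge-weighted profile: `Σ_m cY a m y₁·T_m = 𝟙f((y₁)_a)·(Lc s_m s_f σ_j·T_a)` for the fm charge of `hasSum_dressedStep_fm_col`. -/
theorem sum_fmCharge_mul (Lc : ℕ) (sf sm σ : ℝ) (T : Fin (d + 1) → ℝ) (y₁ : Site (d + 1)) (a : Fin (d + 1)) :
    ∑ m : Fin (d + 1), (if y₁ a % (Lc : ℤ) = (Lc : ℤ) - 1 then ((Lc : ℝ) * (sm * sf)) * (if a = m then σ else 0) else 0) * T m =
      (if y₁ a % (Lc : ℤ) = (Lc : ℤ) - 1 then (1 : ℝ) else 0) * (((Lc : ℝ) * (sm * sf)) * σ * T a) := by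
  rw [Finset.sum_eq_single a (fun m _ hm => by rw [if_neg (Ne.symm hm)]; split_ifs <;> ring) (fun h => absurd (Finset.mem_univ a) h)]
  simp only [if_true]
  split_ifs <;> ring

/-- [folklore] … and for its negative (the fm charge of `sgnK X̃♮_j`). -/
theorem sum_neg_fmCharge_mul (Lc : ℕ) (sf sm σ : ℝ) (T : Fin (d + 1) → ℝ) (y₁ : Site (d + 1)) (a : Fin (d + 1)) :
    ∑ m : Fin (d + 1), (-(if y₁ a % (Lc : ℤ) = (Lc : ℤ) - 1 then ((Lc : ℝ) * (sm * sf)) * (if a = m then σ else 0) else 0)) * T m =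
      (if y₁ a % (Lc : ℤ) = (Lc : ℤ) - 1 then (1 : ℝ) else 0) * (-(((Lc : ℝ) * (sm * sf)) * σ * T a)) := by
  rw [Finset.sum_eq_single a (fun m _ hm => by rw [if_neg (Ne.symm hm)]; split_ifs <;> ring) (fun h => absurd (Finset.mem_univ a) h)]
  simp only [if_true]
  split_ifs <;> ring

/-- [folklore] **THE ZERO-MODE CELL IDENTITY FOR THE FACE-WEIGHTED LEFT WILSON FAMILY** (every level `j`, in-block root, `1 ≤ Lc`, all units, any `μ γ`, any coefficients `κ_a`): with
`j^γ_c(a, y₁) = Σ'_y 𝟙f(y_γ)·vertexOfK X̃♮_j Lc S^E μ c y y₁ (inl γ)(inl a)`,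
`Σ_{c ∈ box Lc} Σ'_{y₁} Σ_a j^γ_{toSite c}(a, y₁)·(𝟙f((y₁)_a)·κ_a) = 0` — covariance regroups the cell sum of first bonds into `|box|·Σ_{r′∈cell} Σ_a (Σ'_v j^γ_v)(a, r′)·𝟙f(r′_a)κ_a`
(`CoarseBondCellPairing`), the resummed left family is `K₁·(−½·curvAdj F_{μγ})` (`tsum_faceHalfVertex_fst`; `0` for `μ = γ`), and §1 kills each `a`. -/
theorem sum_box_leftFamily_face_eq_zero (hLc : 1 ≤ Lc) (hr : r ∈ box (d + 1) Lc) (sf sm cE : ℝ) (j : ℕ) (μ γ : Fin (d + 1)) (κ : Fin (d + 1) → ℝ) :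
    ∑ c ∈ box (d + 1) Lc, ∑' y₁ : Site (d + 1), ∑ a : Fin (d + 1),
        (∑' y : Site (d + 1), (if y γ % (Lc : ℤ) = (Lc : ℤ) - 1 then (1 : ℝ) else 0) *
          vertexOfK (unitK sf sm (coDressKBmAt (toSite r) Lc (KInvStep (d := d) Lc j))) Lc (unitS sf sm (fun κ' v => cE • wilsonA d κ' v)) μ (toSite c) y y₁ (Sum.inl γ) (Sum.inl a)) *
        ((if y₁ a % (Lc : ℤ) = (Lc : ℤ) - 1 then (1 : ℝ) else 0) * κ a) = 0 := by
  classical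
  have hAp : ∀ (a : Fin (d + 1)) (y s : Site (d + 1)), (if (y + (Lc : ℤ) • s) a % (Lc : ℤ) = (Lc : ℤ) - 1 then (1 : ℝ) else 0) * κ a = (if y a % (Lc : ℤ) = (Lc : ℤ) - 1 then (1 : ℝ) else 0) * κ a :=
    fun a y s => by rw [face_weight_periodic Lc a y s]
  have hAb : ∀ (a : Fin (d + 1)) (y : Site (d + 1)), |(if y a % (Lc : ℤ) = (Lc : ℤ) - 1 then (1 : ℝ) else 0) * κ a| ≤ ∑ a' : Fin (d + 1), |κ a'| := by
    intro a y
    have h1 : |(if y a % (Lc : ℤ) = (Lc : ℤ) - 1 then (1 : ℝ) else 0) * κ a| ≤ |κ a| := by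
      rw [abs_mul]; exact mul_le_of_le_one_left (abs_nonneg _) (by split_ifs <;> simp)
    exact h1.trans (Finset.single_le_sum (f := fun a' => |κ a'|) (fun _ _ => abs_nonneg _) (Finset.mem_univ a))
  rw [sum_box_tsum_sum_mul_periodic_of_cov (N := Lc)
    (j := fun (u : Site (d + 1)) (a : Fin (d + 1)) (y₁ : Site (d + 1)) => ∑' y : Site (d + 1), (if y γ % (Lc : ℤ) = (Lc : ℤ) - 1 then (1 : ℝ) else 0) *
      vertexOfK (unitK sf sm (coDressKBmAt (toSite r) Lc (KInvStep (d := d) Lc j))) Lc (unitS sf sm (fun κ' v => cE • wilsonA d κ' v)) μ u y y₁ (Sum.inl γ) (Sum.inl a))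
    (A := fun a y₁ => (if y₁ a % (Lc : ℤ) = (Lc : ℤ) - 1 then (1 : ℝ) else 0) * κ a)
    (fun u a y₁ t => leftFamily_cov (r := r) (μ := μ) (α := γ) hLc sf sm cE j u a y₁ t) (fun a y s => hAp a y s)
    (fun u a => summable_leftFamily_mul (μ := μ) (α := γ) hLc hr sf sm cE j (fun y => hAb a y) u a)]
  refine mul_eq_zero_of_right _ ?_
  by_cases hμγ : μ = γ
  · subst hμγ
    simp only [tsum_faceHalfVertex_fst_diag hLc hr sf sm cE j, zero_mul, Finset.sum_const_zero]
  simp only [tsum_faceHalfVertex_fst hμγ hLc hr sf sm cE j]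
  rw [Finset.sum_comm]
  refine Finset.sum_eq_zero fun a _ => ?_
  have h1 := sum_box_face_mul_curvAdj_eq_zero (N := Lc) (facePlaq_periodic (d := d) Lc μ γ) (g := fun n : ℤ => if n % (Lc : ℤ) = (Lc : ℤ) - 1 then (1 : ℝ) else 0)
    (fun n k => by simp only [Int.add_mul_emod_self_left]) a
  have e : ∀ r' ∈ box (d + 1) Lc,
      (((Lc : ℝ) * (sm * sf)) * ((((Lc ^ (j + 1) : ℕ) : ℝ)) ^ (d + 1 + 1))⁻¹) * ((sf * sm)⁻¹ * (sf⁻¹ * sf⁻¹) * cE) *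
        (-(1 / 2 : ℝ) * curvAdj (fun κ' l (x : Site (d + 1)) =>
          (if κ' = μ ∧ l = γ then (if x μ % (Lc : ℤ) = (Lc : ℤ) - 1 then (1 : ℝ) else 0) * (if x γ % (Lc : ℤ) = (Lc : ℤ) - 1 then (1 : ℝ) else 0) else 0) -
          (if κ' = γ ∧ l = μ then (if x μ % (Lc : ℤ) = (Lc : ℤ) - 1 then (1 : ℝ) else 0) * (if x γ % (Lc : ℤ) = (Lc : ℤ) - 1 then (1 : ℝ) else 0) else 0)) a (toSite r')) *
        ((if toSite r' a % (Lc : ℤ) = (Lc : ℤ) - 1 then (1 : ℝ) else 0) * κ a) =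
      ((((Lc : ℝ) * (sm * sf)) * ((((Lc ^ (j + 1) : ℕ) : ℝ)) ^ (d + 1 + 1))⁻¹) * ((sf * sm)⁻¹ * (sf⁻¹ * sf⁻¹) * cE) * (-(1 / 2 : ℝ)) * κ a) *
        ((if toSite r' a % (Lc : ℤ) = (Lc : ℤ) - 1 then (1 : ℝ) else 0) * curvAdj (fun κ' l (x : Site (d + 1)) =>
          (if κ' = μ ∧ l = γ then (if x μ % (Lc : ℤ) = (Lc : ℤ) - 1 then (1 : ℝ) else 0) * (if x γ % (Lc : ℤ) = (Lc : ℤ) - 1 then (1 : ℝ) else 0) else 0) -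
          (if κ' = γ ∧ l = μ then (if x μ % (Lc : ℤ) = (Lc : ℤ) - 1 then (1 : ℝ) else 0) * (if x γ % (Lc : ℤ) = (Lc : ℤ) - 1 then (1 : ℝ) else 0) else 0)) a (toSite r')) :=
    fun r' _ => by ring
  rw [Finset.sum_congr rfl e, ← Finset.mul_sum, h1, mul_zero]

/-- [folklore] **THE `S^E ⊗ S′` DIRECT WORD, BORDER SLOT ON THE LATTICE BOND, VANISHES IN THE ZERO MODE** (every level `j`, in-block root, `1 ≤ Lc`, all units, any axes; `S′` any local
stencil family with no ff block, block-covariant, multiplier first legs coarse):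
`Σ_{c ∈ box Lc} Σ'_{u′} Σ'_{(y,w)} 𝟙f(y_α)𝟙f(w_β)·((V^E_{μ,c} ∘ X̃♮_j) ∘ Q_{ν,u′}) y w (inl α)(inl β) = 0` — §2 per bond (the fm FACE charge `hasSum_dressedStep_fm_col`), then `sum_box_leftFamily_face_eq_zero`. -/
theorem sum_box_wilson_border_word_eq_zero (hLc : 1 ≤ Lc) (hr : r ∈ box (d + 1) Lc) (sf sm cE : ℝ) (j : ℕ) (hS' : LocStencil S' Cs δs) (hδs : 0 < δs)
    (hS'ff : ∀ (κ' : Fin (d + 1)) (t x z : Site (d + 1)) (α' a : Fin (d + 1)), S' κ' t x z (Sum.inl α') (Sum.inl a) = 0)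
    (hS'cov : ∀ (κ : Fin (d + 1)) (u t : Site (d + 1)), S' κ (u + (Lc : ℤ) • t) = shiftK (-((Lc : ℤ) • t)) (S' κ u))
    (hS'supp : ∀ (κ : Fin (d + 1)) (t z w : Site (d + 1)) (m : Fin (d + 1)) (b : Fib d), off Lc z ≠ 0 → S' κ t z w (Sum.inr m) b = 0) :
    ∑ c ∈ box (d + 1) Lc, ∑' u' : Site (d + 1), ∑' yw : Site (d + 1) × Site (d + 1), (if yw.1 α % (Lc : ℤ) = (Lc : ℤ) - 1 then (1 : ℝ) else 0) * (if yw.2 β % (Lc : ℤ) = (Lc : ℤ) - 1 then (1 : ℝ) else 0) *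
        comp (comp (vertexOfK (unitK sf sm (coDressKBmAt (toSite r) Lc (KInvStep (d := d) Lc j))) Lc (unitS sf sm (fun κ v => cE • wilsonA d κ v)) μ (toSite c))
          (unitK sf sm (coDressKBmAt (toSite r) Lc (KInvStep (d := d) Lc j))))
          (vertexOfK (unitK sf sm (coDressKBmAt (toSite r) Lc (KInvStep (d := d) Lc j))) Lc (unitS sf sm S') ν u') yw.1 yw.2 (Sum.inl α) (Sum.inl β) = 0 := by
  classical
  set X := unitK sf sm (coDressKBmAt (toSite r) Lc (KInvStep (d := d) Lc j)) with hX
  -- common-rate data: the kernel, the Wilson family, the border family, the composed left factor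
  obtain ⟨δK, CK, hδK, hCK, hXd⟩ := decays_coDressKBmAt hLc hr (decays_KInvStep (d := d) (Lc := Lc) j)
  have hXu : Decays X (max |sf| |sm| * CK * max |sf| |sm|) δK := decays_unitK (sf := sf) (sm := sm) hXd
  have hCX : 0 ≤ max |sf| |sm| * CK * max |sf| |sm| := by positivity
  have hCs : 0 ≤ Cs := (hS' 0 0).nonneg (Sum.inl 0)
  set δ₁ : ℝ := min δK δs with hδ₁
  have hδ₁0 : 0 < δ₁ := lt_min hδK hδs
  have hX1 : Decays X (max |sf| |sm| * CK * max |sf| |sm|) δ₁ := decays_mono hXu hCX le_rfl (min_le_left _ _)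
  have hSE := locStencil_unitS (sf := sf) (sm := sm) (locStencil_smul cE (locStencil_wilsonA (d := d) hδ₁0.le))
  have hVE := vertexFamily_vertexOfK (N := Lc) hX1 hCX hSE hδ₁0 le_rfl
  have hQ := vertexFamily_vertexOfK (N := Lc) hX1 hCX (locStencil_unitS (sf := sf) (sm := sm) (fun κ' u => biLoc_mono (hS' κ' u) hCs (min_le_right _ _))) hδ₁0 le_rfl
  have hCv := (hVE μ 0).nonneg (Sum.inl 0)
  have hCq := (hQ μ 0).nonneg (Sum.inl 0)
  have hX2 : Decays X (max |sf| |sm| * CK * max |sf| |sm|) (δ₁ / 2) := decays_mono hX1 hCX le_rfl (by linarith)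
  -- per bond: §2
  have hval : ∀ c : Site (d + 1), (∑' u' : Site (d + 1), ∑' yw : Site (d + 1) × Site (d + 1), (if yw.1 α % (Lc : ℤ) = (Lc : ℤ) - 1 then (1 : ℝ) else 0) * (if yw.2 β % (Lc : ℤ) = (Lc : ℤ) - 1 then (1 : ℝ) else 0) *
        comp (comp (vertexOfK X Lc (unitS sf sm (fun κ v => cE • wilsonA d κ v)) μ c) X) (vertexOfK X Lc (unitS sf sm S') ν u') yw.1 yw.2 (Sum.inl α) (Sum.inl β)) =
      ∑' y₁ : Site (d + 1), ∑ a : Fin (d + 1), (∑' y : Site (d + 1), (if y α % (Lc : ℤ) = (Lc : ℤ) - 1 then (1 : ℝ) else 0) * vertexOfK X Lc (unitS sf sm (fun κ v => cE • wilsonA d κ v)) μ c y y₁ (Sum.inl α) (Sum.inl a)) *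
        ((if y₁ a % (Lc : ℤ) = (Lc : ℤ) - 1 then (1 : ℝ) else 0) * (((Lc : ℝ) * (sm * sf)) * ((((Lc ^ (j + 1) : ℕ) : ℝ)) ^ (d + 1 + 1))⁻¹ *
          (∑' uw : Site (d + 1) × Site (d + 1), (if uw.2 β % (Lc : ℤ) = (Lc : ℤ) - 1 then (1 : ℝ) else 0) * vertexOfK X Lc (unitS sf sm S') ν uw.1 0 uw.2 (Sum.inr a) (Sum.inl β)))) := by
    intro c
    have hA := biLoc_comp_right (hVE μ c) hX2 (show (0 : ℝ) ≤ δ₁ / 4 by positivity) (by linarith)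
    rw [tsum_ffLeft_profile_right_word_eq (N := Lc) (α := α) (β := β) (ρ₁ := fun y : Site (d + 1) => (if y α % (Lc : ℤ) = (Lc : ℤ) - 1 then (1 : ℝ) else 0))
      (ρ₂ := fun w : Site (d + 1) => (if w β % (Lc : ℤ) = (Lc : ℤ) - 1 then (1 : ℝ) else 0)) (show (0 : ℝ) < δ₁ / 4 by positivity) (biLoc_mono (hVE μ c) hCv (by linarith))
      (fun y z α' m => by rw [hX]; exact vertexOfK_wilson_inl_inr _ Lc sf sm cE μ c y z α' m) (decays_mono hX1 hCX le_rfl (by linarith))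
      (fun y₁ a m => by rw [hX]; exact hasSum_dressedStep_fm_col hLc hr sf sm j y₁ a m) hA (fun u => biLoc_mono (hQ ν u) hCq (by linarith))
      (fun u s => by rw [hX]; exact borderSlot_translate (r := r) hLc sf sm j hS'cov ν u s) (fun u z w b' b => vertexOfK_unitS_noFF_inl_inl X Lc sf sm hS'ff ν u z w b' b)
      (fun u z w m b hz => borderSlot_inr_fst_eq_zero X sf sm hS'supp ν u z w m b hz) (fun y => by split_ifs <;> simp) (fun w => by split_ifs <;> simp)
      (fun w s => face_weight_periodic Lc β w s)]
    refine tsum_congr fun y₁ => Finset.sum_congr rfl fun a _ => ?_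
    congr 1
    exact sum_fmCharge_mul (d := d) Lc sf sm (((((Lc ^ (j + 1) : ℕ) : ℝ)) ^ (d + 1 + 1))⁻¹)
      (fun m => ∑' uw : Site (d + 1) × Site (d + 1), (if uw.2 β % (Lc : ℤ) = (Lc : ℤ) - 1 then (1 : ℝ) else 0) * vertexOfK X Lc (unitS sf sm S') ν uw.1 0 uw.2 (Sum.inr m) (Sum.inl β)) y₁ a
  simp only [hX] at hval
  rw [Finset.sum_congr rfl fun c _ => hval (toSite c)]
  exact sum_box_leftFamily_face_eq_zero hLc hr sf sm cE j μ α _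

/-- [folklore] **THE `S′ ⊗ S^E` SWAP WORD, BORDER SLOT ON THE LATTICE BOND (LEFT), VANISHES IN THE ZERO MODE** (every level `j`; here `S′`'s multiplier SECOND legs sit on the coarse
lattice): `Σ_{c ∈ box Lc} Σ'_{u′} Σ'_{(y,w)} 𝟙f(y_α)𝟙f(w_β)·((Q_{ν,u′} ∘ X̃♮_j) ∘ V^E_{μ,c}) y w (inl α)(inl β) = 0` — by transposition (`ExchangeSlotResum.tsum_twoFace_eq_trK`, an5's `trK_comp`,
`trK X̃♮_j = sgnK X̃♮_j`, `trK V^E = −V^E`) each bond's word is MINUS the §2 word with middle kernel `sgnK X̃♮_j` (fm charges negated, `hasSum_sgnK_dressedStep_fm_col`), slot `trK Q` and axes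
`(β, α)`; then `sum_box_leftFamily_face_eq_zero` with the left face `β`. -/
theorem sum_box_border_wilson_swap_word_eq_zero (hLc : 1 ≤ Lc) (hr : r ∈ box (d + 1) Lc) (sf sm cE : ℝ) (j : ℕ) (hS' : LocStencil S' Cs δs) (hδs : 0 < δs)
    (hS'ff : ∀ (κ' : Fin (d + 1)) (t x z : Site (d + 1)) (α' a : Fin (d + 1)), S' κ' t x z (Sum.inl α') (Sum.inl a) = 0)
    (hS'cov : ∀ (κ : Fin (d + 1)) (u t : Site (d + 1)), S' κ (u + (Lc : ℤ) • t) = shiftK (-((Lc : ℤ) • t)) (S' κ u))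
    (hS'supp : ∀ (κ : Fin (d + 1)) (t z w : Site (d + 1)) (a : Fib d) (m : Fin (d + 1)), off Lc w ≠ 0 → S' κ t z w a (Sum.inr m) = 0) :
    ∑ c ∈ box (d + 1) Lc, ∑' u' : Site (d + 1), ∑' yw : Site (d + 1) × Site (d + 1), (if yw.1 α % (Lc : ℤ) = (Lc : ℤ) - 1 then (1 : ℝ) else 0) * (if yw.2 β % (Lc : ℤ) = (Lc : ℤ) - 1 then (1 : ℝ) else 0) *
        comp (comp (vertexOfK (unitK sf sm (coDressKBmAt (toSite r) Lc (KInvStep (d := d) Lc j))) Lc (unitS sf sm S') ν u')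
          (unitK sf sm (coDressKBmAt (toSite r) Lc (KInvStep (d := d) Lc j))))
          (vertexOfK (unitK sf sm (coDressKBmAt (toSite r) Lc (KInvStep (d := d) Lc j))) Lc (unitS sf sm (fun κ v => cE • wilsonA d κ v)) μ (toSite c)) yw.1 yw.2 (Sum.inl α) (Sum.inl β) = 0 := by
  classical
  set X := unitK sf sm (coDressKBmAt (toSite r) Lc (KInvStep (d := d) Lc j)) with hX
  set VE := vertexOfK X Lc (unitS sf sm (fun κ v => cE • wilsonA d κ v)) μ with hVEdef
  set Q := vertexOfK X Lc (unitS sf sm S') ν with hQdef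
  -- common-rate data
  obtain ⟨δK, CK, hδK, hCK, hXd⟩ := decays_coDressKBmAt hLc hr (decays_KInvStep (d := d) (Lc := Lc) j)
  have hXu : Decays X (max |sf| |sm| * CK * max |sf| |sm|) δK := decays_unitK (sf := sf) (sm := sm) hXd
  have hCX : 0 ≤ max |sf| |sm| * CK * max |sf| |sm| := by positivity
  have hCs : 0 ≤ Cs := (hS' 0 0).nonneg (Sum.inl 0)
  set δ₁ : ℝ := min δK δs with hδ₁
  have hδ₁0 : 0 < δ₁ := lt_min hδK hδs
  have hX1 : Decays X (max |sf| |sm| * CK * max |sf| |sm|) δ₁ := decays_mono hXu hCX le_rfl (min_le_left _ _)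
  have hSE := locStencil_unitS (sf := sf) (sm := sm) (locStencil_smul cE (locStencil_wilsonA (d := d) hδ₁0.le))
  have hVE := vertexFamily_vertexOfK (N := Lc) hX1 hCX hSE hδ₁0 le_rfl
  have hQf := vertexFamily_vertexOfK (N := Lc) hX1 hCX (locStencil_unitS (sf := sf) (sm := sm) (fun κ' u => biLoc_mono (hS' κ' u) hCs (min_le_right _ _))) hδ₁0 le_rfl
  have hCv := (hVE μ 0).nonneg (Sum.inl 0)
  have hCq := (hQf μ 0).nonneg (Sum.inl 0)
  have hX2 : Decays X (max |sf| |sm| * CK * max |sf| |sm|) (δ₁ / 2) := decays_mono hX1 hCX le_rfl (by linarith)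
  have hXt : trK X = sgnK X := trK_unitK_coDress hr j sf sm
  have hVEt : ∀ c : Site (d + 1), trK (VE c) = -VE c := fun c =>
    trK_vertexOfK_of_antisymm (K := X) (N := Lc) (fun κ' u x z a b => unitS_wilsonA_antisymm (d := d) sf sm cE κ' u x z a b) μ c
  have hTX : Tame (sgnK X) := Spr.tame ⟨_, _, hδ₁0, decays_sgnK hX1⟩
  have hTVE : ∀ c : Site (d + 1), Tame (VE c) := fun c => Loc.tame ⟨_, _, _, _, half_pos hδ₁0, hVE μ c⟩
  have hTQ : ∀ u' : Site (d + 1), Tame (trK (Q u')) := fun u' => Loc.tame ⟨_, _, _, _, half_pos hδ₁0, biLoc_trK (hQf ν u')⟩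
  -- per bond of the first slot: transpose, then §2 with the negated fm charges
  have hval : ∀ c : Site (d + 1), (∑' u' : Site (d + 1), ∑' yw : Site (d + 1) × Site (d + 1), (if yw.1 α % (Lc : ℤ) = (Lc : ℤ) - 1 then (1 : ℝ) else 0) * (if yw.2 β % (Lc : ℤ) = (Lc : ℤ) - 1 then (1 : ℝ) else 0) *
        comp (comp (Q u') X) (VE c) yw.1 yw.2 (Sum.inl α) (Sum.inl β)) =
      -∑' y₁ : Site (d + 1), ∑ a : Fin (d + 1), (∑' y : Site (d + 1), (if y β % (Lc : ℤ) = (Lc : ℤ) - 1 then (1 : ℝ) else 0) * VE c y y₁ (Sum.inl β) (Sum.inl a)) *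
        ((if y₁ a % (Lc : ℤ) = (Lc : ℤ) - 1 then (1 : ℝ) else 0) * (-(((Lc : ℝ) * (sm * sf)) * ((((Lc ^ (j + 1) : ℕ) : ℝ)) ^ (d + 1 + 1))⁻¹ *
          (∑' uw : Site (d + 1) × Site (d + 1), (if uw.2 α % (Lc : ℤ) = (Lc : ℤ) - 1 then (1 : ℝ) else 0) * trK (Q uw.1) 0 uw.2 (Sum.inr a) (Sum.inl α))))) := by
    intro c
    have e : ∀ u' : Site (d + 1), (∑' yw : Site (d + 1) × Site (d + 1), (if yw.1 α % (Lc : ℤ) = (Lc : ℤ) - 1 then (1 : ℝ) else 0) * (if yw.2 β % (Lc : ℤ) = (Lc : ℤ) - 1 then (1 : ℝ) else 0) *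
          comp (comp (Q u') X) (VE c) yw.1 yw.2 (Sum.inl α) (Sum.inl β)) =
        -∑' wy : Site (d + 1) × Site (d + 1), (if wy.1 β % (Lc : ℤ) = (Lc : ℤ) - 1 then (1 : ℝ) else 0) * (if wy.2 α % (Lc : ℤ) = (Lc : ℤ) - 1 then (1 : ℝ) else 0) *
          comp (comp (VE c) (sgnK X)) (trK (Q u')) wy.1 wy.2 (Sum.inl β) (Sum.inl α) := by
      intro u'
      refine (tsum_twoFace_eq_trK (comp (comp (Q u') X) (VE c)) (fun y : Site (d + 1) => (if y α % (Lc : ℤ) = (Lc : ℤ) - 1 then (1 : ℝ) else 0))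
        (fun w : Site (d + 1) => (if w β % (Lc : ℤ) = (Lc : ℤ) - 1 then (1 : ℝ) else 0)) (Sum.inl α) (Sum.inl β)).trans ?_
      rw [trK_comp, trK_comp, hXt, hVEt c, comp_neg_left, comp_assoc_tame (hTVE c) hTX (hTQ u'), ← tsum_neg]
      exact tsum_congr fun wy => by simp only [Pi.neg_apply]; ring
    rw [tsum_congr e, tsum_neg]
    congr 1
    have hB := biLoc_comp_right (hVE μ c) (decays_sgnK hX2) (show (0 : ℝ) ≤ δ₁ / 4 by positivity) (by linarith)
    rw [tsum_ffLeft_profile_right_word_eq (N := Lc) (α := β) (β := α) (Q := fun u' => trK (Q u'))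
      (ρ₁ := fun w : Site (d + 1) => (if w β % (Lc : ℤ) = (Lc : ℤ) - 1 then (1 : ℝ) else 0))
      (ρ₂ := fun y : Site (d + 1) => (if y α % (Lc : ℤ) = (Lc : ℤ) - 1 then (1 : ℝ) else 0)) (show (0 : ℝ) < δ₁ / 4 by positivity) (biLoc_mono (hVE μ c) hCv (by linarith))
      (fun y z α' m => vertexOfK_wilson_inl_inr _ Lc sf sm cE μ c y z α' m) (decays_mono (decays_sgnK hX1) hCX le_rfl (by linarith))
      (fun y₁ a m => by rw [hX]; exact hasSum_sgnK_dressedStep_fm_col hLc hr sf sm j y₁ a m) hB (fun u => biLoc_trK (biLoc_mono (hQf ν u) hCq (by linarith)))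
      (fun u s => by show trK (Q (u + s)) = _; rw [hQdef, hX, borderSlot_translate (r := r) hLc sf sm j hS'cov ν u s]; rfl)
      (fun u z w b' b => by rw [trK_apply]; exact vertexOfK_unitS_noFF_inl_inl X Lc sf sm hS'ff ν u w z b b')
      (fun u z w m b hz => by rw [trK_apply]; exact borderSlot_inr_snd_eq_zero X sf sm hS'supp ν u w z b m hz) (fun y => by split_ifs <;> simp) (fun w => by split_ifs <;> simp)
      (fun w s => face_weight_periodic Lc α w s)]
    refine tsum_congr fun y₁ => Finset.sum_congr rfl fun a _ => ?_
    congr 1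
    exact sum_neg_fmCharge_mul (d := d) Lc sf sm (((((Lc ^ (j + 1) : ℕ) : ℝ)) ^ (d + 1 + 1))⁻¹)
      (fun m => ∑' uw : Site (d + 1) × Site (d + 1), (if uw.2 α % (Lc : ℤ) = (Lc : ℤ) - 1 then (1 : ℝ) else 0) * trK (Q uw.1) 0 uw.2 (Sum.inr m) (Sum.inl α)) y₁ a
  simp only [hVEdef] at hval
  rw [Finset.sum_congr rfl fun c _ => hval (toSite c), Finset.sum_neg_distrib, neg_eq_zero]
  exact sum_box_leftFamily_face_eq_zero hLc hr sf sm cE j μ β _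

end Instances

end Summit.QuantumFields.BalabanUV.Beta.GAN24.VHWordsZeroCell

end
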